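import Summits.Langlands.Langlands.Theorems.IrreducibilityBySelfDualityIrreducibleOffSectorCliffordGalois
import Summits.Langlands.Langlands.Theorems.IrreducibilityBySelfDualityIrreducibleOffSectorSolvablePrimeIndex
import Summits.Langlands.Langlands.Theorems.IrreducibilityBySelfDualityIrreducibleOffSectorRestrictTower
import Summits.Langlands.Langlands.Theorems.IrreducibilityBySelfDualityIrreducibleOffSectorBaseChange
import Mathlib.FieldTheory.Galois.Basic
import HarnessLib

/-!
# Irreducibility ascends along SOLVABLE extensions of degree prime to the rank
(crux stmt-Langlands-14329 `IrreducibilityBySelfDuality.IrreducibleOffSector`, line `Sketch`;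
`--supports` file, STRUCTURAL: no import of the route module; continuation lead c7)

Iterating the cyclic coprime ascent `isIrreducible_restrictField_of_coprime` (`…CliffordGalois`)
along a tower of cyclic steps of prime degree:

* `isIrreducible_restrictField_of_isSolvable_of_coprime` — `L/K` finite Galois with SOLVABLE Galois
  group and `gcd(n, [L:K]) = 1`, `ρ : Γ_K → GL_n(k)` irreducible (`k` algebraically closed of
  characteristic `0`) ⟹ `ρ|_{Γ_L}` irreducible.  Strong induction on `[L:K]`: a non-trivial finite
  solvable group has a normal subgroup `N` of prime index `p`
  (`exists_normal_prime_index_of_isSolvable`); `E = L^N` is Galois over `K`, cyclic of degree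
  `p ∣ [L:K]` (so `p ∤ n`), hence `ρ|_{Γ_E}` is irreducible; `L/E` is Galois with group `N`, solvable
  of degree `[L:K]/p`, so `(ρ|_{Γ_E})|_{Γ_L}` is irreducible by induction, and this is `ρ|_{Γ_L}` up
  to an inner automorphism of `Γ_K` (`isIrreducible_restrictField_restrictField_iff`).
* `isIrreducible_of_isWeakBaseChangeLiftAE_of_isSolvable` — hence the crux's conclusion ASCENDS along
  weak base change to solvable Galois extensions `L/K` of degree prime to `n` (the extensions for
  which Arthur–Clozel base change exists), given one irreducible avatar of `π` over `K`;
  `irreducibleOffSector_conclusion_ascent_of_isSolvable` — binder shape.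

Examples: `GL_2` along every solvable extension of odd degree (the Langlands–Tunnell towers); `GL_n`
along every solvable extension of degree prime to `n`.

References: A. H. Clifford, Ann. of Math. 38 (1937), Thm. 1; J. Arthur, L. Clozel, *Simple
algebras, base change, and the advanced theory of the trace formula* (1989), Ch. 3, Thm. 4.2 and
Thm. 5.1 (base change for solvable extensions by cyclic steps of prime degree).
-/

noncomputable section

-- `Summit.Langlands.Langlands.…` (summit = sub-problem name, D-0017 layout) trips `dupNamespace`.
set_option linter.dupNamespace false

open scoped NumberField Classical
open Filter IsDedekindDomain
open Literature.RepresentationTheory.Semisimple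
open Literature.NumberTheory.Automorphic Literature.NumberTheory.GaloisRepresentations Field
open Summit.Langlands

namespace Summit.Langlands.Langlands.Theorems.IrreducibleOffSector

universe u v

/-- **Irreducibility ascends along solvable Galois extensions of degree prime to the rank.**  Let
`L/K` be a finite Galois extension with solvable Galois group and `gcd(n, [L:K]) = 1`, and let
`ρ : Γ_K → GL_n(k)` (`k` algebraically closed of characteristic `0`) have irreducible underlying
representation.  Then so has `ρ|_{Γ_L}`.  Strong induction on `[L:K]` through a normal subgroup of
prime index of `Gal(L/K)` (`exists_normal_prime_index_of_isSolvable`), the cyclic coprime ascent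
(`isIrreducible_restrictField_of_coprime`) for `L^N/K`, the induction hypothesis for `L/L^N`, and
transitivity of restriction up to conjugacy (`isIrreducible_restrictField_restrictField_iff`).
[cite: Clifford1937, Thm. 1] -/
theorem isIrreducible_restrictField_of_isSolvable_of_coprime {K L : Type u} [Field K] [Field L]
    [Algebra K L] [FiniteDimensional K L] [IsGalois K L] [IsSolvable (L ≃ₐ[K] L)] {k : Type v}
    [Field k] [IsAlgClosed k] [CharZero k] [TopologicalSpace k] [IsTopologicalRing k] {n : ℕ}
    (hcop : Nat.Coprime n (Module.finrank K L)) (ρ : FramedGaloisRep K k n)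
    (hρ : ρ.toGaloisRep.IsIrreducible) : (ρ.restrictField L).toGaloisRep.IsIrreducible := by
  -- strong induction on the degree, over all base fields in the universe of `L`
  suffices aux : ∀ (d : ℕ) (K' L' : Type u) [Field K'] [Field L'] [Algebra K' L']
      [FiniteDimensional K' L'] [IsGalois K' L'] [IsSolvable (L' ≃ₐ[K'] L')],
      Module.finrank K' L' = d → ∀ (ρ' : FramedGaloisRep K' k n), Nat.Coprime n d →
        ρ'.toGaloisRep.IsIrreducible → (ρ'.restrictField L').toGaloisRep.IsIrreducible from
    aux _ K L rfl ρ hcop hρ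
  intro d
  induction d using Nat.strong_induction_on with
  | _ d ih =>
    intro K' L' _ _ _ _ _ _ hd ρ' hcop' hρ'
    by_cases htriv : Subsingleton (L' ≃ₐ[K'] L')
    · -- trivial Galois group: cyclic, and `gcd(n, d) = 1` always suffices
      haveI := htriv
      exact isIrreducible_restrictField_of_coprime (isCyclic_of_subsingleton) (hd ▸ hcop') ρ' hρ'
    · haveI : Nontrivial (L' ≃ₐ[K'] L') := not_subsingleton_iff_nontrivial.1 htriv
      haveI : Finite (L' ≃ₐ[K'] L') := inferInstance
      -- a normal subgroup of prime index and its fixed field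
      obtain ⟨N, hN, hp⟩ := exists_normal_prime_index_of_isSolvable (G := L' ≃ₐ[K'] L')
      haveI := hN
      haveI hpfact : Fact N.index.Prime := ⟨hp⟩
      set E := IntermediateField.fixedField N with hE
      haveI : IsGalois K' E := IsGalois.of_fixedField_normal_subgroup N
      -- degrees: `[E:K'] = [G:N] = p`, `[L':E] = |N|`, `p * |N| = d`
      have hEK : Module.finrank K' E = N.index := by
        rw [← IsGalois.card_aut_eq_finrank,
          Nat.card_congr (IsGalois.normalAutEquivQuotient N).symm.toEquiv]
        rfl
      have hLE : Module.finrank E L' = Nat.card N := IntermediateField.finrank_fixedField_eq_card N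
      have hmul : N.index * Nat.card N = d := by
        rw [← hEK, ← hLE, Module.finrank_mul_finrank, hd]
      -- the step `K' ⊆ E`: cyclic of prime degree prime to `n`
      have hcycE : IsCyclic (E ≃ₐ[K'] E) :=
        isCyclic_of_prime_card (p := N.index)
          (by rw [IsGalois.card_aut_eq_finrank, hEK])
      have hcopE : Nat.Coprime n (Module.finrank K' E) := by
        rw [hEK]
        exact Nat.Coprime.coprime_dvd_right ⟨Nat.card N, hmul.symm⟩ hcop'
      have hρE : ((ρ'.restrictField E).toGaloisRep).IsIrreducible :=
        isIrreducible_restrictField_of_coprime hcycE hcopE ρ' hρ'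
      -- the step `E ⊆ L'`: Galois with group `N`, solvable, of smaller degree prime to `n`
      haveI : IsSolvable (L' ≃ₐ[E] L') :=
        solvable_of_surjective (f := (IntermediateField.subgroupEquivAlgEquiv N).toMonoidHom)
          fun x => (IntermediateField.subgroupEquivAlgEquiv N).surjective x
      have hlt : Module.finrank E L' < d := by
        rw [hLE, ← hmul]
        have h1 : 1 < N.index := hp.one_lt
        have hpos : 0 < Nat.card N := Nat.card_pos
        calc Nat.card N = 1 * Nat.card N := (one_mul _).symm
          _ < N.index * Nat.card N := Nat.mul_lt_mul_of_pos_right h1 hpos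
      have hcopL : Nat.Coprime n (Module.finrank E L') := by
        rw [hLE]
        exact Nat.Coprime.coprime_dvd_right ⟨N.index, by rw [mul_comm]; exact hmul.symm⟩ hcop'
      have hρEL := ih _ hlt E L' rfl (ρ'.restrictField E) hcopL hρE
      exact (isIrreducible_restrictField_restrictField_iff ρ').1 hρEL

/-- **Base-change ascent of irreducibility along solvable extensions of degree prime to the rank.**
Let `L/K` be a finite Galois extension of number fields with SOLVABLE Galois group and
`gcd(n, [L:K]) = 1`, `Π` on `GL_n(𝔸_L)` a weak base-change lift of `π` on `GL_n(𝔸_K)`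
(`IsWeakBaseChangeLiftAE`), and `ρ₀ : Γ_K → GL_n(ℚ̄_ℓ)` irreducible and Satake–Frobenius compatible
with `(π, ι)` at almost all places.  Then every `ρ' : Γ_L → GL_n(ℚ̄_ℓ)` Satake–Frobenius compatible
with `(Π, ι)` at almost all places is irreducible.
[cite: ArthurClozelAMS120, Ch. 3 §1 (1.1), Thm. 4.2 and Thm. 5.1] -/
theorem isIrreducible_of_isWeakBaseChangeLiftAE_of_isSolvable {K : Type} [Field K] [NumberField K]
    {L : Type} [Field L] [NumberField L] [Algebra K L] [IsGalois K L] [IsSolvable (L ≃ₐ[K] L)]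
    {ℓ : ℕ} [Fact ℓ.Prime] {n : ℕ} {hK : isCompact_glFiniteIntegralLevel n K}
    {hL : isCompact_glFiniteIntegralLevel n L} (hcop : Nat.Coprime n (Module.finrank K L))
    (ι : PadicAlgCl ℓ ≃+* ℂ) (π : AutomorphicRepData (AutomorphyDatum.gl n K hK))
    (P : AutomorphicRepData (AutomorphyDatum.gl n L hL)) (hBC : IsWeakBaseChangeLiftAE π P)
    (ρ₀ : FramedGaloisRep K (PadicAlgCl ℓ) n) (hirr₀ : ρ₀.toGaloisRep.IsIrreducible)
    (h₀ : ∀ᶠ v : HeightOneSpectrum (𝓞 K) in cofinite, SatakeFrobCompatibleAt ι π ρ₀ v)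
    (ρ' : FramedGaloisRep L (PadicAlgCl ℓ) n)
    (hρ' : ∀ᶠ w : HeightOneSpectrum (𝓞 L) in cofinite, SatakeFrobCompatibleAt ι P ρ' w) :
    ρ'.toGaloisRep.IsIrreducible :=
  isIrreducible_of_satakeFrobCompatible P ι
    (isIrreducible_restrictField_of_isSolvable_of_coprime hcop ρ₀ hirr₀)
    (eventually_satakeFrobCompatibleAt_restrictField ι π P hBC ρ₀ h₀) hρ'

/-- **The crux ascends along solvable base change of degree prime to the rank (binder shape).**
GIVEN the conclusion of `IrreducibleOffSector` for `π` on `GL_n(𝔸_K)` at `(ℓ, ι)` (`hIK`) and ONE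
a.e.-compatible `ρ₀`, the conclusion holds at `(ℓ, ι)` for every weak base-change lift `Π` of `π`
to a solvable Galois extension `L/K` with `gcd(n, [L:K]) = 1` — the extensions for which
Arthur–Clozel base change exists.  With the descent (p121124) the crux's conclusion is INVARIANT
under such base changes, given an avatar downstairs.
[cite: ArthurClozelAMS120, Ch. 3 §1 (1.1), Thm. 4.2 and Thm. 5.1] -/
theorem irreducibleOffSector_conclusion_ascent_of_isSolvable {K : Type} [Field K] [NumberField K]
    {L : Type} [Field L] [NumberField L] [Algebra K L] [IsGalois K L] [IsSolvable (L ≃ₐ[K] L)]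
    {ℓ : ℕ} [Fact ℓ.Prime] {n : ℕ} {hK : isCompact_glFiniteIntegralLevel n K}
    {hL : isCompact_glFiniteIntegralLevel n L} (hcop : Nat.Coprime n (Module.finrank K L))
    (ι : PadicAlgCl ℓ ≃+* ℂ) (π : AutomorphicRepData (AutomorphyDatum.gl n K hK))
    (hIK : ∀ ρ : FramedGaloisRep K (PadicAlgCl ℓ) n,
      (∀ᶠ v : HeightOneSpectrum (𝓞 K) in cofinite, SatakeFrobCompatibleAt ι π ρ v) →
        ρ.toGaloisRep.IsIrreducible)
    (ρ₀ : FramedGaloisRep K (PadicAlgCl ℓ) n)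
    (h₀ : ∀ᶠ v : HeightOneSpectrum (𝓞 K) in cofinite, SatakeFrobCompatibleAt ι π ρ₀ v)
    (P : AutomorphicRepData (AutomorphyDatum.gl n L hL)) (hBC : IsWeakBaseChangeLiftAE π P)
    (ρ' : FramedGaloisRep L (PadicAlgCl ℓ) n)
    (hρ' : ∀ᶠ w : HeightOneSpectrum (𝓞 L) in cofinite, SatakeFrobCompatibleAt ι P ρ' w) :
    ρ'.toGaloisRep.IsIrreducible :=
  isIrreducible_of_isWeakBaseChangeLiftAE_of_isSolvable hcop ι π P hBC ρ₀ (hIK ρ₀ h₀) h₀ ρ' hρ'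

end Summit.Langlands.Langlands.Theorems.IrreducibleOffSector

end
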